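import Mathlib
import HarnessLib
import Literature.Geometry.DiscreteGeometry.KissingPatterns
import Literature.Probability.Process.PointStationaryLaw

/-!
# Crux `AperiodicFrustratedLawGap` — TEXTURE TRANSFER III: holes or non-tetrahedral bonds near every atom of the charged configuration

Route `FrustratedLawDichotomy` (and `PeriodicChargeSplit`), crux `AperiodicFrustratedLawGap` (item
`stmt-AtomisticToContinuum-27623`), skeleton `dd3251ad731e`; hand-1 lane, generation 4; part III of the texture toolkit
(I = `…TextureFineShells` p800350, II = `…TextureAllBad` p800775).  Clause (3) of the texture («¬𝔚»: no site of the
`R`-ball of a finite approximant is the centre of an ALL-`1/20`-BAD, SOLID (every point of the `R₇`-ball within `1` of a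
site) and ALL-T (every site `j'` of the `R₇`-ball is tetrahedrally close packed: each bond `k`, `dist (y k) (y j') <
27/20·d_{j'}`, has `≥ 5` common near neighbours) `R₇`-ball) is the anti-Frank–Kasper clause; with clause (2) (all sites
bad) it says: within `R₇` of every site there is a HOLE of radius `> 1` or a NON-T bond.  Both alternatives pass to the
charged configuration `μ` robustly:

* `hole_transfer_core` / `nonT_transfer_core` — engines: a hole of the approximant gives a point `z` with all atoms at
  distance `≥ 1 − ε`; a non-T bond `(j', k)` gives atoms `p₁, p'` with `dist p' p₁ ≤ 27/20·d' + ε`, the scale `d' ≥ 7/10`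
  pinned to the nearest-neighbour distance of `p₁` within `ε`, and AT MOST 4 atoms `m ∉ {p₁, p'}` with
  `dist m p₁ + ε ≤ 27/20·d'` and `dist m p' + ε ≤ 27/20·d'` (the matching restricted to them is an injection into the
  approximant's common-neighbour set, `Nat.card_le_card_of_injective`);
* `holeOrNonT_of_texture` — deterministic: a rooted hard-core configuration with two atoms, texture-charged in the sense of
  clause (d) (separation, clauses (2) and (3), the two matching clauses), has for every `ε > 0`, within `R₇ + ε` of EVERY
  atom, such a hole or such a non-T bond;
* `ae_holeOrNonT_of_texture` — law level with the crux's `let`-bound `Gy`/`TexBall`/`Appr` VERBATIM (clauses (a) + (d)).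

`[folklore]` (elementary metric bookkeeping; no literature content).
-/

noncomputable section

namespace Summit.AtomisticToContinuum.Crystallization.Theorems.FrustratedLawDichotomyTextureHolesOrNonT

open MeasureTheory Literature.Probability.Process Literature.Geometry.DiscreteGeometry

/-- **Two-centre re-centring.**  If `(a, s)` and `(b, s')` are matched pairs (`dist (y a − y i) (s − p) ≤ ε'`, same for
`b, s'`), then `‖(s − s') − (y a − y b)‖ ≤ 2ε'`. [folklore] -/
theorem norm_sub_sub_le_of_matched {N : ℕ} {y : Fin N → EuclideanSpace ℝ (Fin 3)} {i a b : Fin N}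
    {p s s' : EuclideanSpace ℝ (Fin 3)} {ε' : ℝ}
    (ha : dist (y a - y i) (s - p) ≤ ε') (hb : dist (y b - y i) (s' - p) ≤ ε') :
    ‖(s - s') - (y a - y b)‖ ≤ 2 * ε' := by
  have hid : (s - s') - (y a - y b) = ((y b - y i) - (s' - p)) - ((y a - y i) - (s - p)) := by abel
  rw [hid]
  calc ‖((y b - y i) - (s' - p)) - ((y a - y i) - (s - p))‖
      ≤ ‖(y b - y i) - (s' - p)‖ + ‖(y a - y i) - (s - p)‖ := norm_sub_le _ _
    _ ≤ ε' + ε' := by rw [← dist_eq_norm, ← dist_eq_norm]; exact add_le_add hb ha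
    _ = 2 * ε' := by ring

/-- **Hole-transfer engine.**  A point `z₀` of the approximant frame at distance `> 1` from every site, within `L` of the
centre `y i`, gives — for a separated `S` whose `R`-ball around `p` is matched into `y` (`R ≥ L + 2`, tolerance
`ε' ≤ ε`) — the point `z = p + (z₀ − y i)` with `dist z p ≤ L` and every atom at distance `≥ 1 − ε`. [folklore] -/
theorem hole_transfer_core {S : Set (EuclideanSpace ℝ (Fin 3))}
    {N : ℕ} {y : Fin N → EuclideanSpace ℝ (Fin 3)} {i : Fin N} {p z₀ : EuclideanSpace ℝ (Fin 3)} {R L ε ε' : ℝ}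
    (hm1 : ∀ s ∈ S, dist s p ≤ R → ∃ a : Fin N, dist (y a - y i) (s - p) ≤ ε')
    (hz₀ : ∀ a : Fin N, ¬ dist z₀ (y a) ≤ 1) (hz₀L : dist z₀ (y i) ≤ L) (hε' : ε' ≤ ε) (hε0 : 0 ≤ ε) (hR : L + 2 ≤ R) :
    dist (p + (z₀ - y i)) p ≤ L ∧ ∀ s ∈ S, 1 - ε ≤ dist s (p + (z₀ - y i)) := by
  refine ⟨by rwa [dist_eq_norm, add_sub_cancel_left, ← dist_eq_norm], fun s hs => ?_⟩
  by_cases hsR : dist s p ≤ R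
  · obtain ⟨a, ha⟩ := hm1 s hs hsR
    have h1 := lt_of_not_ge (hz₀ a)
    have h2 : dist z₀ (y a) ≤ ε' + dist s (p + (z₀ - y i)) := by
      rw [dist_eq_norm] at ha
      rw [dist_eq_norm, dist_eq_norm]
      calc ‖z₀ - y a‖ = ‖y a - z₀‖ := norm_sub_rev _ _
        _ = ‖((y a - y i) - (s - p)) + (s - (p + (z₀ - y i)))‖ := by congr 1; abel
        _ ≤ ‖(y a - y i) - (s - p)‖ + ‖s - (p + (z₀ - y i))‖ := norm_add_le _ _
        _ ≤ ε' + ‖s - (p + (z₀ - y i))‖ := by linarith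
    linarith
  · push Not at hsR
    have h1 : dist s p ≤ dist s (p + (z₀ - y i)) + dist (p + (z₀ - y i)) p := dist_triangle _ _ _
    have h2 : dist (p + (z₀ - y i)) p ≤ L := by rwa [dist_eq_norm, add_sub_cancel_left, ← dist_eq_norm]
    linarith

/-- **Non-T-transfer engine.**  Data: a `δ`-separated `S ∋ p, p₁, p'`; a finite `7/10`-separated `y`, two-way `ε'`-matched
to `S` re-centred at `p` inside radius `R`; sites `j'` (within `L` of the centre, matched to `p₁`) and `k` (matched to
`p'`) with `y k ≠ y j'` and `dist (y k) (y j') < 27/20·d'`, `d'` the nearest-neighbour distance of `j'`, `d' ≤ B`; numerics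
`0 < ε`, `4ε' ≤ ε`, `2ε' < δ`, `ε' ≤ 1/4`, `27/20·B + B + L + 2 ≤ R`.  Conclusion: `7/10 ≤ d'`; `d'` is the nearest-neighbour
distance of `p₁` up to `ε` (both ways); `p' ≠ p₁`, `dist p' p₁ ≤ 27/20·d' + ε`; and if the bond `(j', k)` has `< 5` common
near neighbours in `y`, then at most `4` atoms `m ∉ {p₁, p'}` have `dist m p₁ + ε ≤ 27/20·d'` and `dist m p' + ε ≤ 27/20·d'`.
[folklore] -/
theorem nonT_transfer_core {S : Set (EuclideanSpace ℝ (Fin 3))} {δ : ℝ}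
    (hS : ∀ x ∈ S, ∀ x' ∈ S, x ≠ x' → δ ≤ dist x x')
    {N : ℕ} {y : Fin N → EuclideanSpace ℝ (Fin 3)} {i j' k : Fin N} {p p₁ p' : EuclideanSpace ℝ (Fin 3)}
    {R L ε ε' B d' : ℝ}
    (hsepY : ∀ a b : Fin N, a ≠ b → (7 : ℝ) / 10 ≤ dist (y a) (y b))
    (hm1 : ∀ s ∈ S, dist s p ≤ R → ∃ a : Fin N, dist (y a - y i) (s - p) ≤ ε')
    (hm2 : ∀ a : Fin N, dist (y a) (y i) ≤ R → ∃ s ∈ S, dist (y a - y i) (s - p) ≤ ε')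
    (hp₁S : p₁ ∈ S) (hp₁ : dist (y j' - y i) (p₁ - p) ≤ ε') (hj'L : dist (y j') (y i) ≤ L)
    (hp'S : p' ∈ S) (hp' : dist (y k - y i) (p' - p) ≤ ε') (hkj' : y k ≠ y j')
    (hd' : d' = sInf ((fun z => dist z (y j')) '' (Set.range y \ {y j'}))) (hk : dist (y k) (y j') < 27 / 20 * d')
    (hB : d' ≤ B) (hε : 0 < ε) (h4ε' : 4 * ε' ≤ ε) (h2ε' : 2 * ε' < δ) (hε'1 : ε' ≤ 1 / 4)
    (hR : 27 / 20 * B + B + L + 2 ≤ R) :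
    (7 : ℝ) / 10 ≤ d' ∧ (∀ s ∈ S, s ≠ p₁ → d' ≤ dist s p₁ + ε) ∧ (∃ s ∈ S, s ≠ p₁ ∧ dist s p₁ ≤ d' + ε) ∧
    p' ≠ p₁ ∧ dist p' p₁ ≤ 27 / 20 * d' + ε ∧
    (¬ 5 ≤ Nat.card {m : Fin N // y m ≠ y j' ∧ dist (y m) (y j') < 27 / 20 * d' ∧ y m ≠ y k ∧ dist (y m) (y k) < 27 / 20 * d'} →
      Nat.card {m : EuclideanSpace ℝ (Fin 3) // m ∈ S ∧ m ≠ p₁ ∧ dist m p₁ + ε ≤ 27 / 20 * d' ∧ m ≠ p' ∧ dist m p' + ε ≤ 27 / 20 * d'} ≤ 4) := by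
  have hε'0 : 0 ≤ ε' := le_trans dist_nonneg hp₁
  -- matched pairs: distinctness transfers both ways, distances up to `2ε'`
  have ne_of_y : ∀ {a b : Fin N} {s s' : EuclideanSpace ℝ (Fin 3)}, dist (y a - y i) (s - p) ≤ ε' →
      dist (y b - y i) (s' - p) ≤ ε' → y a ≠ y b → s ≠ s' := by
    intro a b s s' ha hb hne hss
    have h1 := norm_sub_sub_le_of_matched ha hb
    rw [hss, sub_self, zero_sub, norm_neg, ← dist_eq_norm] at h1
    have h2 : (7 : ℝ) / 10 ≤ dist (y a) (y b) := hsepY a b (fun h => hne (by rw [h]))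
    linarith
  have ne_of_S : ∀ {a b : Fin N} {s s' : EuclideanSpace ℝ (Fin 3)}, s ∈ S → s' ∈ S → dist (y a - y i) (s - p) ≤ ε' →
      dist (y b - y i) (s' - p) ≤ ε' → s ≠ s' → y a ≠ y b := by
    intro a b s s' hs hs' ha hb hne hyy
    have h1 := norm_sub_sub_le_of_matched ha hb
    rw [hyy, sub_self, sub_zero, ← dist_eq_norm] at h1
    have h2 := hS s hs s' hs' hne
    linarith
  have dist_le : ∀ {a b : Fin N} {s s' : EuclideanSpace ℝ (Fin 3)}, dist (y a - y i) (s - p) ≤ ε' →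
      dist (y b - y i) (s' - p) ≤ ε' → dist s s' ≤ dist (y a) (y b) + 2 * ε' ∧ dist (y a) (y b) ≤ dist s s' + 2 * ε' := by
    intro a b s s' ha hb
    have h1 := norm_sub_sub_le_of_matched ha hb
    rw [dist_eq_norm, dist_eq_norm]
    constructor
    · calc ‖s - s'‖ = ‖(y a - y b) + ((s - s') - (y a - y b))‖ := by congr 1; abel
        _ ≤ ‖y a - y b‖ + ‖(s - s') - (y a - y b)‖ := norm_add_le _ _
        _ ≤ ‖y a - y b‖ + 2 * ε' := by linarith
    · calc ‖y a - y b‖ = ‖(s - s') - ((s - s') - (y a - y b))‖ := by congr 1; abel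
        _ ≤ ‖s - s'‖ + ‖(s - s') - (y a - y b)‖ := norm_sub_le _ _
        _ ≤ ‖s - s'‖ + 2 * ε' := by linarith
  have hp₁p : dist p₁ p ≤ L + ε' := by
    have h1 : ‖(p₁ - p) - (y j' - y i)‖ ≤ ε' := by rw [← dist_eq_norm, dist_comm]; exact hp₁
    rw [dist_eq_norm]
    calc ‖p₁ - p‖ = ‖(y j' - y i) + ((p₁ - p) - (y j' - y i))‖ := by congr 1; abel
      _ ≤ ‖y j' - y i‖ + ‖(p₁ - p) - (y j' - y i)‖ := norm_add_le _ _
      _ ≤ L + ε' := add_le_add (by rw [← dist_eq_norm]; exact hj'L) h1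
  -- the distance set of `j'`
  have hDne : ((fun z => dist z (y j')) '' (Set.range y \ {y j'})).Nonempty :=
    ⟨_, ⟨y k, ⟨⟨k, rfl⟩, hkj'⟩, rfl⟩⟩
  have hDfin : ((fun z => dist z (y j')) '' (Set.range y \ {y j'})).Finite :=
    ((Set.finite_range y).subset fun x hx => hx.1).image _
  have hDbdd : BddBelow ((fun z => dist z (y j')) '' (Set.range y \ {y j'})) :=
    ⟨0, by rintro b ⟨z, -, rfl⟩; exact dist_nonneg⟩
  have hd'7 : (7 : ℝ) / 10 ≤ d' := by
    rw [hd']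
    refine le_csInf hDne ?_
    rintro b ⟨z, ⟨⟨a, rfl⟩, hz⟩, rfl⟩
    exact hsepY a j' (fun h => hz (by rw [h]; rfl))
  have hd'_le : ∀ a : Fin N, y a ≠ y j' → d' ≤ dist (y a) (y j') :=
    fun a ha => hd' ▸ csInf_le hDbdd ⟨y a, ⟨⟨a, rfl⟩, ha⟩, rfl⟩
  refine ⟨hd'7, ?_, ?_, (ne_of_y hp' hp₁ hkj'), ?_, ?_⟩
  · -- lower pinning
    intro s hs hne
    by_cases hsR : dist s p ≤ R
    · obtain ⟨a, ha⟩ := hm1 s hs hsR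
      have hay := ne_of_S hs hp₁S ha hp₁ hne
      have h1 := hd'_le a hay
      have h2 := (dist_le ha hp₁).2
      linarith
    · push Not at hsR
      have h1 : dist s p ≤ dist s p₁ + dist p₁ p := dist_triangle _ _ _
      linarith
  · -- upper pinning: the nearest site of `j'` is matched
    obtain ⟨z, ⟨⟨a, rfl⟩, haj⟩, hza⟩ := hDne.csInf_mem hDfin
    have haj' : y a ≠ y j' := fun h => haj h
    have hza' : dist (y a) (y j') = d' := by rw [hd']; exact hza
    have haR : dist (y a) (y i) ≤ R := by
      have := dist_triangle (y a) (y j') (y i)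
      linarith
    obtain ⟨s, hs, has⟩ := hm2 a haR
    refine ⟨s, hs, ne_of_y has hp₁ haj', ?_⟩
    have := (dist_le has hp₁).1
    linarith
  · have := (dist_le hp' hp₁).1
    linarith
  · -- the common-neighbour count: the matching is an injection into the approximant's set
    intro hC
    have hC' : Nat.card {m : Fin N // y m ≠ y j' ∧ dist (y m) (y j') < 27 / 20 * d' ∧ y m ≠ y k ∧ dist (y m) (y k) < 27 / 20 * d'} ≤ 4 := by
      omega
    have hmatch : ∀ m : {m : EuclideanSpace ℝ (Fin 3) // m ∈ S ∧ m ≠ p₁ ∧ dist m p₁ + ε ≤ 27 / 20 * d' ∧ m ≠ p' ∧ dist m p' + ε ≤ 27 / 20 * d'},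
        ∃ a : {m : Fin N // y m ≠ y j' ∧ dist (y m) (y j') < 27 / 20 * d' ∧ y m ≠ y k ∧ dist (y m) (y k) < 27 / 20 * d'},
          dist (y a.1 - y i) (m.1 - p) ≤ ε' := by
      rintro ⟨m, hmS, hm₁, hd₁, hm', hd₂⟩
      have hmR : dist m p ≤ R := by
        have := dist_triangle m p₁ p
        linarith
      obtain ⟨a, ha⟩ := hm1 m hmS hmR
      have h1 := ne_of_S hmS hp₁S ha hp₁ hm₁
      have h2 := ne_of_S hmS hp'S ha hp' hm'
      have h3 := (dist_le ha hp₁).2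
      have h4 := (dist_le ha hp').2
      exact ⟨⟨a, h1, by linarith, h2, by linarith⟩, ha⟩
    choose g hg using hmatch
    refine (Nat.card_le_card_of_injective g fun m m' hmm => ?_).trans hC'
    have h1 := hg m
    have h2 := hg m'
    rw [hmm] at h1
    have h3 := (dist_le h1 h2).1
    rw [dist_self] at h3
    apply Subtype.ext
    by_contra hne
    have := hS m.1 m.2.1 m'.1 m'.2.1 hne
    linarith

/-- **Holes or non-T bonds near every atom of a texture-charged configuration (deterministic).**  Let `μ = count|S` be a
rooted `δ`-hard-core configuration (`δ > 0`) with two distinct atoms `p`, `p₂`, texture-charged in the sense of clause (d)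
of the crux with radius `R₇` (only the separation of the approximants, their clauses (2) «all sites of the `R`-ball are
`1/20`-bad» and (3) «no all-bad solid all-T `R₇`-ball centred in the `R`-ball», and the two matching clauses are assumed).
Then for every `ε > 0`: EITHER there is a point `z` with `dist z p ≤ R₇ + ε` and every atom at distance `≥ 1 − ε` (a
hole), OR there are atoms `p₁` (`dist p₁ p ≤ R₇ + ε`) and `p' ≠ p₁` with `dist p' p₁ ≤ 27/20·d' + ε`, where `d' ≥ 7/10` is the
nearest-neighbour distance of `p₁` up to `ε`, such that at most `4` atoms `m ∉ {p₁, p'}` satisfy `dist m p₁ + ε ≤ 27/20·d'`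
and `dist m p' + ε ≤ 27/20·d'` (a robustly non-tetrahedral bond).  Proof: match a large ball around `p` finely; at the site
`j` matched to `p`, clause (2) supplies the all-bad conjunct of clause (3), so the approximant has a hole or a non-T bond
within `R₇` of `y j`; transfer by `hole_transfer_core` / `nonT_transfer_core`. [folklore] -/
theorem holeOrNonT_of_texture {δ : ℝ} (hδ : 0 < δ) {μ : Measure (EuclideanSpace ℝ (Fin 3))} (hμ : IsRootedHardCore δ μ)
    {R₇ : ℝ}
    (h : ∀ q : EuclideanSpace ℝ (Fin 3), μ {q} ≠ 0 → ∀ R ε : ℝ, 0 < ε → ∃ (N : ℕ) (y : Fin N → EuclideanSpace ℝ (Fin 3)) (i : Fin N),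
      (∀ a b : Fin N, a ≠ b → (7 : ℝ) / 10 ≤ dist (y a) (y b)) ∧
      (∀ j : Fin N, dist (y j) (y i) ≤ R → ¬ ∃ A : EuclideanSpace ℝ (Fin 3) →ₗᵢ[ℝ] EuclideanSpace ℝ (Fin 3),
          (∃ e : ↥{z : EuclideanSpace ℝ (Fin 3) | z ∈ Set.range y ∧ z ≠ y j ∧ dist z (y j) < 13 / 10 * sInf ((fun z => dist z (y j)) '' (Set.range y \ {y j}))} ≃ ↥Literature.Geometry.DiscreteGeometry.fccKissingPattern, ∀ t : ↥{z : EuclideanSpace ℝ (Fin 3) | z ∈ Set.range y ∧ z ≠ y j ∧ dist z (y j) < 13 / 10 * sInf ((fun z => dist z (y j)) '' (Set.range y \ {y j}))}, dist ((sInf ((fun z => dist z (y j)) '' (Set.range y \ {y j})))⁻¹ • ((t : EuclideanSpace ℝ (Fin 3)) - y j)) (A ((e t : ↥Literature.Geometry.DiscreteGeometry.fccKissingPattern) : EuclideanSpace ℝ (Fin 3))) ≤ 1 / 20) ∨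
          (∃ e : ↥{z : EuclideanSpace ℝ (Fin 3) | z ∈ Set.range y ∧ z ≠ y j ∧ dist z (y j) < 13 / 10 * sInf ((fun z => dist z (y j)) '' (Set.range y \ {y j}))} ≃ ↥Literature.Geometry.DiscreteGeometry.hcpKissingPattern, ∀ t : ↥{z : EuclideanSpace ℝ (Fin 3) | z ∈ Set.range y ∧ z ≠ y j ∧ dist z (y j) < 13 / 10 * sInf ((fun z => dist z (y j)) '' (Set.range y \ {y j}))}, dist ((sInf ((fun z => dist z (y j)) '' (Set.range y \ {y j})))⁻¹ • ((t : EuclideanSpace ℝ (Fin 3)) - y j)) (A ((e t : ↥Literature.Geometry.DiscreteGeometry.hcpKissingPattern) : EuclideanSpace ℝ (Fin 3))) ≤ 1 / 20)) ∧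
      (∀ j : Fin N, dist (y j) (y i) ≤ R → ¬ ((∀ j' : Fin N, dist (y j') (y j) ≤ R₇ → ¬ ∃ A : EuclideanSpace ℝ (Fin 3) →ₗᵢ[ℝ] EuclideanSpace ℝ (Fin 3),
          (∃ e : ↥{z : EuclideanSpace ℝ (Fin 3) | z ∈ Set.range y ∧ z ≠ y j' ∧ dist z (y j') < 13 / 10 * sInf ((fun z => dist z (y j')) '' (Set.range y \ {y j'}))} ≃ ↥Literature.Geometry.DiscreteGeometry.fccKissingPattern, ∀ t : ↥{z : EuclideanSpace ℝ (Fin 3) | z ∈ Set.range y ∧ z ≠ y j' ∧ dist z (y j') < 13 / 10 * sInf ((fun z => dist z (y j')) '' (Set.range y \ {y j'}))}, dist ((sInf ((fun z => dist z (y j')) '' (Set.range y \ {y j'})))⁻¹ • ((t : EuclideanSpace ℝ (Fin 3)) - y j')) (A ((e t : ↥Literature.Geometry.DiscreteGeometry.fccKissingPattern) : EuclideanSpace ℝ (Fin 3))) ≤ 1 / 20) ∨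
          (∃ e : ↥{z : EuclideanSpace ℝ (Fin 3) | z ∈ Set.range y ∧ z ≠ y j' ∧ dist z (y j') < 13 / 10 * sInf ((fun z => dist z (y j')) '' (Set.range y \ {y j'}))} ≃ ↥Literature.Geometry.DiscreteGeometry.hcpKissingPattern, ∀ t : ↥{z : EuclideanSpace ℝ (Fin 3) | z ∈ Set.range y ∧ z ≠ y j' ∧ dist z (y j') < 13 / 10 * sInf ((fun z => dist z (y j')) '' (Set.range y \ {y j'}))}, dist ((sInf ((fun z => dist z (y j')) '' (Set.range y \ {y j'})))⁻¹ • ((t : EuclideanSpace ℝ (Fin 3)) - y j')) (A ((e t : ↥Literature.Geometry.DiscreteGeometry.hcpKissingPattern) : EuclideanSpace ℝ (Fin 3))) ≤ 1 / 20)) ∧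
        (∀ z : EuclideanSpace ℝ (Fin 3), dist z (y j) ≤ R₇ → ∃ k : Fin N, dist z (y k) ≤ 1) ∧
        (∀ j' : Fin N, dist (y j') (y j) ≤ R₇ → ∀ k : Fin N, y k ≠ y j' → dist (y k) (y j') < 27 / 20 * sInf ((fun z => dist z (y j')) '' (Set.range y \ {y j'})) →
          5 ≤ Nat.card {m : Fin N // y m ≠ y j' ∧ dist (y m) (y j') < 27 / 20 * sInf ((fun z => dist z (y j')) '' (Set.range y \ {y j'})) ∧ y m ≠ y k ∧ dist (y m) (y k) < 27 / 20 * sInf ((fun z => dist z (y j')) '' (Set.range y \ {y j'}))}))) ∧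
      (∀ s : EuclideanSpace ℝ (Fin 3), μ {s} ≠ 0 → dist s q ≤ R → ∃ a : Fin N, dist (y a - y i) (s - q) ≤ ε) ∧
      (∀ a : Fin N, dist (y a) (y i) ≤ R → ∃ s : EuclideanSpace ℝ (Fin 3), μ {s} ≠ 0 ∧ dist (y a - y i) (s - q) ≤ ε))
    {p p₂ : EuclideanSpace ℝ (Fin 3)} (hp : μ {p} ≠ 0) (hp₂ : μ {p₂} ≠ 0) (hne : p₂ ≠ p) {ε : ℝ} (hε : 0 < ε) :
    (∃ z : EuclideanSpace ℝ (Fin 3), dist z p ≤ R₇ + ε ∧ ∀ s : EuclideanSpace ℝ (Fin 3), μ {s} ≠ 0 → 1 - ε ≤ dist s z) ∨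
    (∃ p₁ : EuclideanSpace ℝ (Fin 3), μ {p₁} ≠ 0 ∧ dist p₁ p ≤ R₇ + ε ∧ ∃ d' : ℝ, (7 : ℝ) / 10 ≤ d' ∧
      (∀ s : EuclideanSpace ℝ (Fin 3), μ {s} ≠ 0 → s ≠ p₁ → d' ≤ dist s p₁ + ε) ∧ (∃ s : EuclideanSpace ℝ (Fin 3), μ {s} ≠ 0 ∧ s ≠ p₁ ∧ dist s p₁ ≤ d' + ε) ∧
      ∃ p' : EuclideanSpace ℝ (Fin 3), μ {p'} ≠ 0 ∧ p' ≠ p₁ ∧ dist p' p₁ ≤ 27 / 20 * d' + ε ∧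
        Nat.card {m : EuclideanSpace ℝ (Fin 3) // μ {m} ≠ 0 ∧ m ≠ p₁ ∧ dist m p₁ + ε ≤ 27 / 20 * d' ∧ m ≠ p' ∧ dist m p' + ε ≤ 27 / 20 * d'} ≤ 4) := by
  obtain ⟨S, -, hS, hμS⟩ := hμ
  have hmem : ∀ q : EuclideanSpace ℝ (Fin 3), μ {q} ≠ 0 ↔ q ∈ S := fun q => by
    rw [hμS]; exact count_restrict_singleton_ne_zero_iff S q
  have hpS : p ∈ S := (hmem p).1 hp
  have hp₂S : p₂ ∈ S := (hmem p₂).1 hp₂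
  set D : ℝ := dist p₂ p with hD
  have hDδ : δ ≤ D := hS p₂ hp₂S p hpS hne
  set ε' : ℝ := min (min (ε / 4) (δ / 4)) (1 / 4) with hε'
  have hε'pos : 0 < ε' := lt_min (lt_min (by linarith) (by linarith)) (by norm_num)
  have h4ε' : 4 * ε' ≤ ε := by
    have : ε' ≤ ε / 4 := (min_le_left _ _).trans (min_le_left _ _)
    linarith
  have h2ε' : 2 * ε' < δ := by
    have : ε' ≤ δ / 4 := (min_le_left _ _).trans (min_le_right _ _)
    linarith
  have hε'1 : ε' ≤ 1 / 4 := min_le_right _ _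
  have hR₇abs : R₇ ≤ |R₇| := le_abs_self R₇
  have habs0 : 0 ≤ |R₇| := abs_nonneg R₇
  set B : ℝ := |R₇| + D + 1 with hB
  set L : ℝ := |R₇| + 1 with hL
  set R : ℝ := 27 / 20 * B + B + L + 2 with hRdef
  have hR0 : 0 ≤ R := by positivity
  obtain ⟨N, y, i, hsepY, hcl2, hcl3, hm1, hm2⟩ := h p hp R ε' hε'pos
  have hm1' : ∀ s ∈ S, dist s p ≤ R → ∃ a : Fin N, dist (y a - y i) (s - p) ≤ ε' :=
    fun s hs => hm1 s ((hmem s).2 hs)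
  have hm2' : ∀ a : Fin N, dist (y a) (y i) ≤ R → ∃ s ∈ S, dist (y a - y i) (s - p) ≤ ε' := fun a ha => by
    obtain ⟨s, hs, h⟩ := hm2 a ha
    exact ⟨s, (hmem s).1 hs, h⟩
  -- the site matched to `p` and clause (3) there
  obtain ⟨j, hj⟩ := hm1' p hpS (by rw [dist_self]; exact hR0)
  have hyj : dist (y j) (y i) ≤ ε' := by
    have h1 := hj
    rwa [sub_self, dist_zero_right, ← dist_eq_norm] at h1
  have h3j := hcl3 j (by linarith)
  have hA : ∀ j' : Fin N, dist (y j') (y j) ≤ R₇ → ¬ ∃ A : EuclideanSpace ℝ (Fin 3) →ₗᵢ[ℝ] EuclideanSpace ℝ (Fin 3),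
          (∃ e : ↥{z : EuclideanSpace ℝ (Fin 3) | z ∈ Set.range y ∧ z ≠ y j' ∧ dist z (y j') < 13 / 10 * sInf ((fun z => dist z (y j')) '' (Set.range y \ {y j'}))} ≃ ↥Literature.Geometry.DiscreteGeometry.fccKissingPattern, ∀ t : ↥{z : EuclideanSpace ℝ (Fin 3) | z ∈ Set.range y ∧ z ≠ y j' ∧ dist z (y j') < 13 / 10 * sInf ((fun z => dist z (y j')) '' (Set.range y \ {y j'}))}, dist ((sInf ((fun z => dist z (y j')) '' (Set.range y \ {y j'})))⁻¹ • ((t : EuclideanSpace ℝ (Fin 3)) - y j')) (A ((e t : ↥Literature.Geometry.DiscreteGeometry.fccKissingPattern) : EuclideanSpace ℝ (Fin 3))) ≤ 1 / 20) ∨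
          (∃ e : ↥{z : EuclideanSpace ℝ (Fin 3) | z ∈ Set.range y ∧ z ≠ y j' ∧ dist z (y j') < 13 / 10 * sInf ((fun z => dist z (y j')) '' (Set.range y \ {y j'}))} ≃ ↥Literature.Geometry.DiscreteGeometry.hcpKissingPattern, ∀ t : ↥{z : EuclideanSpace ℝ (Fin 3) | z ∈ Set.range y ∧ z ≠ y j' ∧ dist z (y j') < 13 / 10 * sInf ((fun z => dist z (y j')) '' (Set.range y \ {y j'}))}, dist ((sInf ((fun z => dist z (y j')) '' (Set.range y \ {y j'})))⁻¹ • ((t : EuclideanSpace ℝ (Fin 3)) - y j')) (A ((e t : ↥Literature.Geometry.DiscreteGeometry.hcpKissingPattern) : EuclideanSpace ℝ (Fin 3))) ≤ 1 / 20) := by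
    intro j' hj'
    refine hcl2 j' ?_
    have := dist_triangle (y j') (y j) (y i)
    linarith
  by_cases hsolid : ∀ z : EuclideanSpace ℝ (Fin 3), dist z (y j) ≤ R₇ → ∃ k : Fin N, dist z (y k) ≤ 1
  · -- no hole: some site of the `R₇`-ball has a non-T bond
    right
    have hC := fun hC => h3j ⟨hA, hsolid, hC⟩
    obtain ⟨j', hj'⟩ := not_forall.mp hC
    obtain ⟨hj'R, hC2⟩ := Classical.not_imp.mp hj'
    obtain ⟨k, hk⟩ := not_forall.mp hC2
    obtain ⟨hkj', hk2⟩ := Classical.not_imp.mp hk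
    obtain ⟨hkd, hcnt⟩ := Classical.not_imp.mp hk2
    set d' : ℝ := sInf ((fun z => dist z (y j')) '' (Set.range y \ {y j'})) with hd'
    have hDbdd : BddBelow ((fun z => dist z (y j')) '' (Set.range y \ {y j'})) :=
      ⟨0, by rintro b ⟨z, -, rfl⟩; exact dist_nonneg⟩
    have hd'_le : ∀ a : Fin N, y a ≠ y j' → d' ≤ dist (y a) (y j') :=
      fun a ha => csInf_le hDbdd ⟨y a, ⟨⟨a, rfl⟩, ha⟩, rfl⟩
    have hj'L : dist (y j') (y i) ≤ L := by
      have := dist_triangle (y j') (y j) (y i)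
      linarith
    -- the scale of `j'` is at most `B`
    have hd'B : d' ≤ B := by
      by_cases hjj : y j ≠ y j'
      · have := hd'_le j hjj
        rw [dist_comm] at hj'R
        linarith
      · push Not at hjj
        obtain ⟨a₂, ha₂⟩ := hm1' p₂ hp₂S (by linarith)
        have h1 := norm_sub_sub_le_of_matched ha₂ hj
        have hne' : y a₂ ≠ y j' := by
          intro hh
          rw [hh, ← hjj, sub_self, sub_zero, ← dist_eq_norm] at h1
          linarith
        have h2 := hd'_le a₂ hne'
        have h3 : dist (y a₂) (y j') ≤ D + 2 * ε' := by
          rw [← hjj, dist_eq_norm]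
          calc ‖y a₂ - y j‖ = ‖(p₂ - p) - ((p₂ - p) - (y a₂ - y j))‖ := by congr 1; abel
            _ ≤ ‖p₂ - p‖ + ‖(p₂ - p) - (y a₂ - y j)‖ := norm_sub_le _ _
            _ ≤ ‖p₂ - p‖ + 2 * ε' := by linarith
            _ = D + 2 * ε' := by rw [hD, dist_eq_norm]
        linarith
    -- matched atoms of `j'` and `k`
    obtain ⟨p₁, hp₁S, hp₁⟩ := hm2' j' (by linarith)
    have hkR : dist (y k) (y i) ≤ R := by
      have := dist_triangle (y k) (y j') (y i)
      nlinarith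
    obtain ⟨p', hp'S, hp'⟩ := hm2' k hkR
    have hRB : 27 / 20 * B + B + L + 2 ≤ R := le_rfl
    obtain ⟨h7, hlow, ⟨s₁, hs₁S, hs₁ne, hs₁d⟩, hne₁, hdist, hcount⟩ :=
      nonT_transfer_core hS hsepY hm1' hm2' hp₁S hp₁ hj'L hp'S hp' hkj' hd' hkd hd'B hε h4ε' h2ε' hε'1 hRB
    have hp₁p : dist p₁ p ≤ R₇ + ε := by
      have h1 := norm_sub_sub_le_of_matched hp₁ hj
      have h2 : dist p₁ p ≤ dist (y j') (y j) + 2 * ε' := by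
        rw [dist_eq_norm, dist_eq_norm]
        calc ‖p₁ - p‖ = ‖(y j' - y j) + ((p₁ - p) - (y j' - y j))‖ := by congr 1; abel
          _ ≤ ‖y j' - y j‖ + ‖(p₁ - p) - (y j' - y j)‖ := norm_add_le _ _
          _ ≤ ‖y j' - y j‖ + 2 * ε' := by linarith
      linarith
    refine ⟨p₁, (hmem p₁).2 hp₁S, hp₁p, d', h7, fun s hs => hlow s ((hmem s).1 hs),
      ⟨s₁, (hmem s₁).2 hs₁S, hs₁ne, hs₁d⟩, p', (hmem p').2 hp'S, hne₁, hdist, ?_⟩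
    have hcard := hcount hcnt
    rwa [Nat.card_congr (Equiv.subtypeEquivRight (fun m => by rw [hmem]) :
      {m : EuclideanSpace ℝ (Fin 3) // μ {m} ≠ 0 ∧ m ≠ p₁ ∧ dist m p₁ + ε ≤ 27 / 20 * d' ∧ m ≠ p' ∧ dist m p' + ε ≤ 27 / 20 * d'} ≃
      {m : EuclideanSpace ℝ (Fin 3) // m ∈ S ∧ m ≠ p₁ ∧ dist m p₁ + ε ≤ 27 / 20 * d' ∧ m ≠ p' ∧ dist m p' + ε ≤ 27 / 20 * d'})]
  · -- a hole of the approximant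
    left
    obtain ⟨z₀, hz₀⟩ := not_forall.mp hsolid
    obtain ⟨hz₀R, hz₀'⟩ := Classical.not_imp.mp hz₀
    have hz₀'' : ∀ a : Fin N, ¬ dist z₀ (y a) ≤ 1 := fun a ha => hz₀' ⟨a, ha⟩
    have hz₀L : dist z₀ (y i) ≤ R₇ + ε' := by
      have := dist_triangle z₀ (y j) (y i)
      linarith
    obtain ⟨h1, h2⟩ := hole_transfer_core hm1' hz₀'' hz₀L (by linarith : ε' ≤ ε) hε.le (by linarith : R₇ + ε' + 2 ≤ R)
    exact ⟨p + (z₀ - y i), by linarith, fun s hs => h2 s ((hmem s).1 hs)⟩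

/-- **Clauses (a) + (d) of the crux ⟹ almost surely a hole or a non-T bond within `R₇ + ε` of every atom** (law level,
the crux's `let`-bound `Gy` / `TexBall` / `Appr` VERBATIM): for every `δ > 0`, every law `P` with `P`-a.s. rooted
`δ`-hard-core configurations and every choice of texture radii with `P`-a.s. `Appr μ R₇ R₈ R₉`, `P`-almost surely, for
every `ε > 0` and all distinct atoms `p₂ ≠ p`, the alternative of `holeOrNonT_of_texture` holds at `p`. [folklore] -/
theorem ae_holeOrNonT_of_texture :
    ∀ P : MeasureTheory.Measure (MeasureTheory.Measure (EuclideanSpace ℝ (Fin 3))), let Gy : ℝ → (N : ℕ) → (Fin N → EuclideanSpace ℝ (Fin 3)) → Fin N → Prop := fun η N y j => let d : ℝ := sInf ((fun z => dist z (y (j : Fin N))) '' (Set.range (y) \ {(y (j : Fin N))})); let T : Set (EuclideanSpace ℝ (Fin 3)) := {z : EuclideanSpace ℝ (Fin 3) | z ∈ Set.range (y) ∧ z ≠ (y (j : Fin N)) ∧ dist z (y (j : Fin N)) < 13 / 10 * d}; ∃ A : EuclideanSpace ℝ (Fin 3) →ₗᵢ[ℝ] EuclideanSpace ℝ (Fin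 3), (∃ e : ↥T ≃ ↥Literature.Geometry.DiscreteGeometry.fccKissingPattern, ∀ t : ↥T, dist (d⁻¹ • ((t : EuclideanSpace ℝ (Fin 3)) - (y (j : Fin N)))) (A ((e t : ↥Literature.Geometry.DiscreteGeometry.fccKissingPattern) : EuclideanSpace ℝ (Fin 3))) ≤ η) ∨ (∃ e : ↥T ≃ ↥Literature.Geometry.DiscreteGeometry.hcpKissingPattern, ∀ t : ↥T, dist (d⁻¹ • ((t : EuclideanSpace ℝ (Fin 3)) - (y (j : Fin N)))) (A ((e t : ↥Literature.Geometry.DiscreteGeometry.hcpKissingPattern) : EuclideanSpace ℝ (Fin 3))) ≤ η); let TexBall : (N : ℕ) → (Fin N → EuclideanSpace ℝ (Fin 3)) → Fin N → ℝ → ℝ → ℝ → ℝ → Prop := fun N y i R R₇ R₈ R₉ => (∀ a b : Fin N, a ≠ b → (7 : ℝ) / 10 ≤ dist (y a) (y b)) ∧ (∀ j : Fin N, dist (y j) (y i) ≤ R → ¬ Gy (1 / 20) N (y) j) ∧ (∀ j : Fin N, dist (y j) (y i) ≤ R → ¬ ((∀ j' : Fin N, dist (y j') (y j) ≤ R₇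 → ¬ Gy (1 / 20) N (y) j') ∧ (∀ z : EuclideanSpace ℝ (Fin 3), dist z (y j) ≤ R₇ → ∃ k : Fin N, dist z (y k) ≤ 1) ∧ (∀ j' : Fin N, dist (y j') (y j) ≤ R₇ → (let d : ℝ := sInf ((fun z => dist z (y j')) '' (Set.range (y) \ {(y j')})); ∀ k : Fin N, y k ≠ y j' → dist (y k) (y j') < 27 / 20 * d → 5 ≤ Nat.card {m : Fin N // y m ≠ y j' ∧ dist (y m) (y j') < 27 / 20 * d ∧ y m ≠ y k ∧ dist (y m) (y k) < 27 / 20 * d})))) ∧ (∀ j : Fin N, dist (y j) (y i) ≤ R → ∃ k : Fin N, dist (y k) (y j) ≤ R₈ ∧ Gy (1 / 8) N (y) k) ∧ (∀ j : Fin N, dist (y j) (y i) ≤ R → ¬ ((∀ j' : Fin N, dist (y j') (y j) ≤ R₉ → ¬ Gy (1 / 20) N (y) j') ∧ (Nat.card {j' : Fin N // dist (y j') (y j) ≤ R₉ ∧ ¬ Gy (1 / 8) N (y) j'} : ℝ) ≤ 1 / 2 * (Nat.card {j' : Fin N // dist (y j') (y j) ≤ R₉} : ℝ) ∧ (∀ j'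 : Fin N, dist (y j') (y j) ≤ R₉ → ¬ Gy (1 / 8) N (y) j' → ¬ (let d : ℝ := sInf ((fun z => dist z (y j')) '' (Set.range (y) \ {(y j')})); ∀ k : Fin N, y k ≠ y j' → dist (y k) (y j') < 27 / 20 * d → 5 ≤ Nat.card {m : Fin N // y m ≠ y j' ∧ dist (y m) (y j') < 27 / 20 * d ∧ y m ≠ y k ∧ dist (y m) (y k) < 27 / 20 * d})))); let Appr : MeasureTheory.Measure (EuclideanSpace ℝ (Fin 3)) → ℝ → ℝ → ℝ → Prop := fun μ R₇ R₈ R₉ => ∀ q : EuclideanSpace ℝ (Fin 3), μ {q} ≠ 0 → ∀ R ε : ℝ, 0 < ε → ∃ (N : ℕ) (y : Fin N → EuclideanSpace ℝ (Fin 3)) (i : Fin N), TexBall N y i R R₇ R₈ R₉ ∧ (∀ p : EuclideanSpace ℝ (Fin 3), μ {p} ≠ 0 → dist p q ≤ R → ∃ k : Fin N, dist (y k - y i) (p - q) ≤ ε) ∧ (∀ k : Fin N, dist (y k) (y i) ≤ R → ∃ p : EuclideanSpace ℝ (Fin 3), μ {p} ≠ 0 ∧ dist (y k - y i) (p - q)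 ≤ ε);  ∀ δ : ℝ, 0 < δ → (∀ᵐ μ ∂P, Literature.Probability.Process.IsRootedHardCore δ μ) → ∀ R₇ R₈ R₉ : ℝ, (∀ᵐ μ ∂P, Appr μ R₇ R₈ R₉) →
      ∀ᵐ μ ∂P, ∀ ε : ℝ, 0 < ε → ∀ p p₂ : EuclideanSpace ℝ (Fin 3), μ {p} ≠ 0 → μ {p₂} ≠ 0 → p₂ ≠ p →
        (∃ z : EuclideanSpace ℝ (Fin 3), dist z p ≤ R₇ + ε ∧ ∀ s : EuclideanSpace ℝ (Fin 3), μ {s} ≠ 0 → 1 - ε ≤ dist s z) ∨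
        (∃ p₁ : EuclideanSpace ℝ (Fin 3), μ {p₁} ≠ 0 ∧ dist p₁ p ≤ R₇ + ε ∧ ∃ d' : ℝ, (7 : ℝ) / 10 ≤ d' ∧
          (∀ s : EuclideanSpace ℝ (Fin 3), μ {s} ≠ 0 → s ≠ p₁ → d' ≤ dist s p₁ + ε) ∧ (∃ s : EuclideanSpace ℝ (Fin 3), μ {s} ≠ 0 ∧ s ≠ p₁ ∧ dist s p₁ ≤ d' + ε) ∧
          ∃ p' : EuclideanSpace ℝ (Fin 3), μ {p'} ≠ 0 ∧ p' ≠ p₁ ∧ dist p' p₁ ≤ 27 / 20 * d' + ε ∧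
            Nat.card {m : EuclideanSpace ℝ (Fin 3) // μ {m} ≠ 0 ∧ m ≠ p₁ ∧ dist m p₁ + ε ≤ 27 / 20 * d' ∧ m ≠ p' ∧ dist m p' + ε ≤ 27 / 20 * d'} ≤ 4) := by
  intro P
  dsimp only
  intro δ hδ ha R₇ R₈ R₉ hd
  filter_upwards [ha, hd] with μ hμ hμ' ε hε p p₂ hp hp₂ hne
  refine holeOrNonT_of_texture hδ hμ (R₇ := R₇) (fun q hq R ε' hε' => ?_) hp hp₂ hne hε
  obtain ⟨N, y, i, ⟨hsep, h2, h3, -, -⟩, hm1, hm2⟩ := hμ' q hq R ε' hε'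
  exact ⟨N, y, i, hsep, h2, h3, hm1, hm2⟩

end Summit.AtomisticToContinuum.Crystallization.Theorems.FrustratedLawDichotomyTextureHolesOrNonT

end
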